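import Literature.MathematicalPhysics.QuantumFieldTheory.Balaban1983to89.B1Eq324BenfattoKernelSect5PerBoxAppD
import Literature.MathematicalPhysics.QuantumFieldTheory.Balaban1983to89.B1Eq324BenfattoKernelSect5PavementStep
import HarnessLib

/-!
# `Balaban1983to89.B1Eq324BenfattoKernelSect5PerBoxAtPavementUpper` — [BenfattoEtAl1978] §5 pp. 157–159, (5.36) p. 159: THE PER-BOX RELATION AT THE
# CLASS ROAD'S PART FIELDS, UPPER DIRECTION UNDER THE EXTRA CONDITIONING — the `hbox` hypothesis of the class UPPER pavement chain
# (`…KernelSect5PavementChainUpper.upperPavementChainCond`, seat n08-d): `∫_{χ^□_b} e^{Ψ_□} dN ≤ e^{u_□}·∫_{χ^□_b} e^{Ψ′₁+Ψ₂} dN` under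
# `N = 𝒩(u_{C∪Γ₁}(ξ), Kb □)` for every tessera `□ ∈ B` and every datum `ξ` that is `γb`-small on `Γ₁` and `b`-small on `C` — SUPPLIED from the
# cluster-side rows with `u_□ := E_□ + Err_□` EXPLICIT (row 10U of the seat's port map; the mirror of `…KernelSect5PerBoxAtPavement`)

statement-level skeleton of published theorems with citation tags; proofs where landed; nothing here is a claim about the
Yang–Mills mass gap

WHY THIS MODULE (cell `pub-ymgap`, seat `dag-n08-c` gen 31; node N08 [Balaban1985UV3]; the [BenfattoEtAl1978] source chain behind the (α)-row `h324`;
the (4.6) side of the class port).  Seat n08-d's class upper chain `…KernelSect5PavementChainUpper.upperPavementChainCond(_le_exp)` (p619737) takes, at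
every step and every tessera `□ = □_m` (`m ∈ B`), for every datum `ξ` in the corridor event `χ^{Γ₁}_{γb}` AND the conditioning event `χ^{C}_{b}`, a per-box
UPPER bound in set-integral currency under the part field whose centre is the conditional mean GIVEN `C ∪ Γ₁` (the far conditioning set `C` of (4.6)
travels with the chain).  Row 9 of the cluster side (`…KernelSect5PerBoxAppD.perBox_shift_appD`) is TWO-SIDED (`|log lhs − log rhs − E| ≤ Err`, fifth
conjunct `lhs ≤ e^{E+Err}·rhs`) and takes the centre `u` as a letter with rows; this file reads it at `u := condMean K (C ∪ Γ₁) ξ`, part kernel `Kb m`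
(parts `□′∪Γ₂(□) = shrink L m w`, the STANDARD part-kernel row — print's `C` is `b³`-far from the boxes, so `C` misses every `shrink L m w`; n08-d's
`partKernel_row_sdiff_of_disjoint` converts the row to the chain's `shrink ∖ C` indexing), reference field `𝒩(0,K)`.  Discharged here: R0/R1 as in row 10,
and the conditioning row (h) «`z = ξ` on `Γ₁` a.s.» from n08-d's `…KernelSect5Eq513.partField_ae_eqOn` at `Γ := C ∪ Γ₁` (needs `C ⊆ Λ` and
`shrink L m w ∩ C = ∅`).  DISPLAYED, uniformly in `m ∈ B` and in the datum (both events): rows (a), (b), (e), (f)-kernel as in row 10, and the CENTRE rows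
for the union conditioning — (c) `|u_{C∪Γ₁}(ξ)| ≤ Kᵤ` on `I`, (d) `≤ ε₃₁` on `□′∪Γ₃(□)`, (f) `≤ ½b(1+d(Δ_x,I))` on `□′∪Γ₂(□)` (their class suppliers for a
far `C` are the union editions of `…KernelSect5PartFieldRows` §2/§4, to come) — and the coefficient masses `M`, `M̃`.

WHAT IS PROVED (theorems only; no definition, no named fact, no `sorry`; axioms standard).
* ★★ `hboxU_of_clusterRows` — the hypothesis `hbox` of `upperPavementChainCond` at one step VERBATIM (standard parts), with
  `u m := E m + Err m`, `E m = Σ_{k<t}(Σ_{f uses Ψ″₁, avoids Ψ₂} 𝓔^T_{𝒩(0,K)}(f))/(k+1)!` and `Err m` row 9's error at box `m` — the same `E`, `Err` as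
  row 10's lower exponent `ℓ m = E m − Err m`.

HONEST SCOPE / NOT HERE.  The centre rows for `C ∪ Γ₁` stay DISPLAYED here; the upper identification / chain / ledger / knit are the sequel
(`…KernelSect5StepBoundUpper`, `…UpperAssembly`); no generalised Basic Lemma is stated; one self-located row of an UNCOMMISSIONED port (plan g81 (II),
START-LIST v11 §n08) — nothing chained; nothing of [Balaban1985UV3] is asserted; count-neutral for N08; nothing about d = 4, the continuum, OS axioms,
a mass gap or the Clay problem.
-/

noncomputable section

open MeasureTheory ProbabilityTheory Finset Matrix
open scoped BigOperators Nat NNReal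

namespace Literature.MathematicalPhysics.QuantumFieldTheory.Balaban1983to89.B1Eq324BenfattoKernelSect5PerBoxAtPavementUpper

open _root_.MeasureTheory _root_.ProbabilityTheory
open Literature.Probability.LatticeModels (setPartitions ursellOf)
open Literature.MathematicalPhysics.QuantumFieldTheory
open Literature.MathematicalPhysics.QuantumFieldTheory.Balaban1983to89.B1Eq324BenfattoLemma
open Literature.MathematicalPhysics.QuantumFieldTheory.Balaban1983to89.B1Eq324BenfattoSect5Boxes
open Literature.MathematicalPhysics.QuantumFieldTheory.Balaban1983to89.B1Eq324BenfattoSect5Eq511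
open Literature.MathematicalPhysics.QuantumFieldTheory.Balaban1983to89.B1Eq324BenfattoSect5Eq524
open Literature.MathematicalPhysics.QuantumFieldTheory.Balaban1983to89.B1Eq324BenfattoSect5Eq534
open Literature.MathematicalPhysics.QuantumFieldTheory.Balaban1983to89.B1Eq324BenfattoSect5Eq515
open Literature.MathematicalPhysics.QuantumFieldTheory.Balaban1983to89.B1Eq324BenfattoSect5Iteration (restrictCoef)
open Literature.MathematicalPhysics.QuantumFieldTheory.Balaban1983to89.B1Eq324BenfattoKernelOfPrecision (isPosSemidefKernel_kernel)
open Literature.MathematicalPhysics.QuantumFieldTheory.Balaban1983to89.B1Eq324BenfattoClassAppendixC (posDef_of_coercive)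
open Literature.MathematicalPhysics.QuantumFieldTheory.Balaban1983to89.B1Eq324BenfattoKernelSect5Eq513 (partField_ae_eqOn)
open Literature.MathematicalPhysics.QuantumFieldTheory.Balaban1983to89.B1Eq324BenfattoKernelSect5Eq515 (shrink_subset_sdiff_corridors)
open Literature.MathematicalPhysics.QuantumFieldTheory.Balaban1983to89.B1Eq324BenfattoKernelSect5PerBoxAppD (perBox_shift_appD)
open Literature.MathematicalPhysics.QuantumFieldTheory.Balaban1983to89.B1Eq324GaussianMomentLeaf (momentConst)

variable {d : ℕ}

/-! ## §1  `hbox` from the cluster rows -/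
section HBox

variable {Λ : Finset (B1Eq324BenfattoLemma.Site d)} {A : Matrix Λ Λ ℝ}
  {K : B1Eq324BenfattoLemma.Site d → B1Eq324BenfattoLemma.Site d → ℝ}
  (hK : ∀ x y, K x y = if h : x ∈ Λ ∧ y ∈ Λ then (A⁻¹ : Matrix Λ Λ ℝ) ⟨x, h.1⟩ ⟨y, h.2⟩ else 0)
  {s D : ℕ} {κ : ℝ} {a : Coef d} {J I : Finset (B1Eq324BenfattoLemma.Site d)} {L w v : ℕ} {B : Finset (B1Eq324BenfattoLemma.Site d)}
  {γ b Ac : ℝ}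
  (hAs : ∀ e e', A e e' = A e' e) {γA : ℝ} (hγA0 : 0 < γA)
  (hγA : ∀ x : Λ → ℝ, γA * ∑ e, x e ^ 2 ≤ ∑ e, ∑ e', A e e' * x e * x e')
  (hL : 0 < L)
  (hΓΛ : corridors L w B ⊆ Λ) (hBΛ : ∀ m ∈ B, box L m ⊆ Λ)
  {Kb : B1Eq324BenfattoLemma.Site d → B1Eq324BenfattoLemma.Site d → B1Eq324BenfattoLemma.Site d → ℝ}
  (hKb : ∀ m (hm : m ∈ B) x y, Kb m x y = if h : x ∈ shrink L m w ∧ y ∈ shrink L m w then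
    ((A.submatrix (fun j : ↥(shrink L m w) => (⟨j, hBΛ m hm (shrink_subset_box L m w j.2)⟩ : Λ))
      (fun j : ↥(shrink L m w) => (⟨j, hBΛ m hm (shrink_subset_box L m w j.2)⟩ : Λ)))⁻¹ :
        Matrix ↥(shrink L m w) ↥(shrink L m w) ℝ) ⟨x, h.1⟩ ⟨y, h.2⟩ else 0)

include hK hAs hγA0 hγA hL hΓΛ hKb

/-- ★★ **UPPER `hbox` FROM THE CLUSTER ROWS, UNDER THE EXTRA CONDITIONING**: for every tessera `□ = □_m`, `m ∈ B`, and every datum `ξ` with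
`χ^{Γ₁}_{γb}(ξ) = 1` and `χ^{C}_{b}(ξ) = 1` (`Γ₁ = corridors L w B`; `C ⊆ Λ` missing every `□′∪Γ₂(□)`),
`∫_{χ^□_b} e^{Ψ_□} dN ≤ e^{E_□ + Err_□} · ∫_{χ^□_b} e^{Ψ′₁+Ψ₂} dN`, `N = (gaussianFieldOfKernel (Kb m)).map (u_{C∪Γ₁}(ξ) + ·)` — row 9's
`perBox_shift_appD` (fifth conjunct) at the centre `u := condMean K (C ∪ Γ₁) ξ`, reference field `𝒩(0,K)`; R0 from `isPosSemidefKernel_kernel` at the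
sub-precision, R1 from row (a), the conditioning row from `partField_ae_eqOn` at `Γ := C ∪ Γ₁` restricted to `Γ₁`; rows (a)–(f) (centre rows in the
union form) and the masses DISPLAYED uniformly in `m ∈ B` and in the datum.  `E_□`, `Err_□` as in row 10 (`…KernelSect5PerBoxAtPavement.hbox_of_clusterRows`).
[cite: BenfattoEtAl1978, (5.30)–(5.33) pp.158–159, (5.36) p.159 «the same bound holds for the conditional expectation»] -/
theorem hboxU_of_clusterRows (hκ : 0 < κ) (hJ : CoefSupportedIn a J) (hJI : J ⊆ I) (hAc0 : 0 ≤ Ac)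
    (hA : ∀ (p : ℕ) (Δ : Fin p → B1Eq324BenfattoLemma.Site d) (n : Fin p → ℕ), |a p Δ n| ≤ Ac)
    (hv : v ≤ w) (hb : 1 ≤ b) (hγ1 : γ ≤ 1)
    {C : Finset (B1Eq324BenfattoLemma.Site d)} (hCΛ : C ⊆ Λ) (hCsh : ∀ m ∈ B, Disjoint (shrink L m w) C)
    {Ku K₀ δ₀ ε₃₁ : ℝ} (hKu : 0 ≤ Ku) (hKuK : Ku ≤ K₀) (hK₀1 : 1 ≤ K₀) (hε₃₁ : 0 ≤ ε₃₁)
    (hu : ∀ ξ ∈ smallFieldOn (corridors L w B : Set (B1Eq324BenfattoLemma.Site d)) I (γ * b),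
      ξ ∈ smallFieldOn ((C : Finset (B1Eq324BenfattoLemma.Site d)) : Set (B1Eq324BenfattoLemma.Site d)) I b →
      ∀ y ∈ I, |condMean K (C ∪ corridors L w B) ξ y| ≤ Ku)
    (hKR : ∀ m ∈ B, ∀ x y, |Kb m x y| ≤ K₀) (hKrR : ∀ x y, |K x y| ≤ K₀)
    (hdec : ∀ m ∈ B, ∀ x y : B1Eq324BenfattoLemma.Site d,
      |Kb m x y| ≤ K₀ * Real.exp (-(δ₀ * ∑ jj, |((x jj : ℝ) - (y jj : ℝ))|)))
    (huε : ∀ m ∈ B, ∀ ξ ∈ smallFieldOn (corridors L w B : Set (B1Eq324BenfattoLemma.Site d)) I (γ * b),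
      ξ ∈ smallFieldOn ((C : Finset (B1Eq324BenfattoLemma.Site d)) : Set (B1Eq324BenfattoLemma.Site d)) I b →
      ∀ x ∈ shrink L m (w + (w - v)), |condMean K (C ∪ corridors L w B) ξ x| ≤ ε₃₁)
    (hKε : ∀ m ∈ B, ∀ x ∈ shrink L m (w + (w - v)), ∀ y, |Kb m x y - K x y| ≤ ε₃₁)
    (hvar : ∀ m ∈ B, ∀ x ∈ shrink L m w, Kb m x x ≤ 1 / 2)
    (hm : ∀ m ∈ B, ∀ ξ ∈ smallFieldOn (corridors L w B : Set (B1Eq324BenfattoLemma.Site d)) I (γ * b),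
      ξ ∈ smallFieldOn ((C : Finset (B1Eq324BenfattoLemma.Site d)) : Set (B1Eq324BenfattoLemma.Site d)) I b →
      ∀ x ∈ shrink L m w, |condMean K (C ∪ corridors L w B) ξ x| ≤ 1 / 2 * b * (1 + distToRegion I x))
    (hsmall : ∀ m ∈ B, ((shrink L m w).card : ℝ) * Real.exp (-(b ^ 2 / 4)) ≤ 1 / 6)
    (T : B1Eq324BenfattoLemma.Site d → Fin 3 → (p : ℕ) → Finset (Fin p → J))
    (hT0 : ∀ m p, T m 0 p = tuplesIn J p (frame4 L w v m) ∪ crossT J p (frame4 L w v m) (frame3 L w v m))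
    (hT1 : ∀ m p, T m 1 p = (tuplesIn J p (core L w m) \ tuplesIn J p (frame4 L w v m)) ∪
      (crossT J p (core L w m) (frame3 L w v m) \ crossT J p (frame4 L w v m) (frame3 L w v m)))
    (hT2 : ∀ m p, T m 2 p = crossT J p (frame1 L w m) (frame2 L w m) ∪ tuplesIn J p (frame2 L w m))
    {M : ℝ} (hM : ∀ m c, ∑ p ∈ Finset.Icc 1 s, ∑ Δ ∈ T m c p, ∑ n ∈ admissible p D,
      |a p (fun i => (Δ i : B1Eq324BenfattoLemma.Site d)) n| *
        Real.exp (-(κ / 2) * connLength fun i => (Δ i : B1Eq324BenfattoLemma.Site d)) ≤ M)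
    {δ : ℝ} (hδ0 : 0 ≤ δ) (hδle : δ ≤ δ₀) {Mt : ℝ}
    (hMt : ∀ m c, ∑ p ∈ Finset.Icc 1 s, ∑ Δ ∈ T m c p, ∑ n ∈ admissible p D,
      |a p (fun i => (Δ i : B1Eq324BenfattoLemma.Site d)) n| *
        Real.exp (-(κ / 2) * connLength fun i => (Δ i : B1Eq324BenfattoLemma.Site d)) *
        Real.exp (δ / 2 * ((D : ℝ) ^ 2 * (Real.sqrt d * connLength (fun i => (Δ i : B1Eq324BenfattoLemma.Site d)) + d))) ≤ Mt)
    (t : ℕ) :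
    ∀ m ∈ B, ∀ ξ : B1Eq324BenfattoLemma.Site d → ℝ, ξ ∈ smallFieldOn (corridors L w B : Set (B1Eq324BenfattoLemma.Site d)) I (γ * b) →
      ξ ∈ smallFieldOn ((C : Finset (B1Eq324BenfattoLemma.Site d)) : Set (B1Eq324BenfattoLemma.Site d)) I b →
      ∫ z in smallFieldOn (shrink L m w : Set (B1Eq324BenfattoLemma.Site d)) I b,
          Real.exp (psiBox s D κ a L w m z) ∂((gaussianFieldOfKernel (Kb m)).map
              fun (ζ : B1Eq324BenfattoLemma.Site d → ℝ) (x : B1Eq324BenfattoLemma.Site d) => condMean K (C ∪ corridors L w B) ξ x + ζ x)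
        ≤ Real.exp
          ((∑ k ∈ Finset.range t,
              (∑ f ∈ univ.filter (fun f : Fin (k + 1) → Fin 3 => (∃ j, f j = 1) ∧ ∀ j, f j ≠ 2),
                ursellOf (fun P : Finset (Fin (k + 1)) => ∫ z, ∏ j ∈ P,
                  (∑ p ∈ Finset.Icc 1 s, ∑ Δ ∈ T m (f j) p, ∑ n ∈ admissible p D, term κ a z p Δ n)
                    ∂(gaussianFieldOfKernel K)) univ) / (k + 1)!) +
            (2 * (2 ^ ((t + 1).choose 2) * (4 * (s1Const s D d κ * Ac * b ^ D * (L : ℝ) ^ d)) ^ (t + 1) / (t + 1)!) +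
              Real.exp (2 * (4 * (s1Const s D d κ * Ac * b ^ D * (L : ℝ) ^ d))) *
                (3 * (((shrink L m w).card : ℝ) * Real.exp (-(b ^ 2 / 4)))) +
              ∑ k ∈ Finset.range t,
                (3 ^ (k + 1) * ((∑ π ∈ setPartitions (univ : Finset (Fin (k + 1))), ((π.card - 1)! : ℝ)) *
                    (s1Const s D d κ * Ac * b ^ D * Real.exp (-(κ / 4 * v)) * (L : ℝ) ^ d *
                      (4 * (s1Const s D d κ * Ac * b ^ D * (L : ℝ) ^ d)) ^ k)) +
                  3 ^ (k + 1) * (2 ^ (k + 1) * ((∑ π ∈ setPartitions (univ : Finset (Fin (k + 1))), ((π.card - 1)! : ℝ)) *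
                      ((min 1 (2 * ((shrink L m w).card : ℝ) * Real.exp (-(b ^ 2 / 4)))) ^ ((2 * (k + 1) : ℕ) : ℝ)⁻¹ *
                        ((1 + Ku) ^ D * M * momentConst D (2 * (k + 1)) K₀.toNNReal) ^ (k + 1))) +
                    2 ^ ((k + 1) * D) * 2 ^ 2 ^ ((k + 1) * D) * K₀ ^ ((k + 1) * D) * Real.exp (-(δ / 2 * ((v : ℝ) + 1))) *
                      Mt ^ (k + 1)) +
                  3 ^ (k + 1) * (2 ^ (k + 1) * ((∑ π ∈ setPartitions (univ : Finset (Fin (k + 1))), ((π.card - 1)! : ℝ)) *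
                      ((min 1 (2 * ((shrink L m w).card : ℝ) * Real.exp (-(b ^ 2 / 4)))) ^ ((2 * (k + 1) : ℕ) : ℝ)⁻¹ *
                        ((1 + Ku) ^ D * M * momentConst D (2 * (k + 1)) K₀.toNNReal) ^ (k + 1))) +
                    M ^ (k + 1) * (2 ^ ((k + 1) * D) * 2 ^ 2 ^ ((k + 1) * D) *
                      ((((k + 1) * D : ℕ) : ℝ) * K₀ ^ ((k + 1) * D) * ε₃₁)))) / (k + 1)!)) *
        ∫ z in smallFieldOn (shrink L m w : Set (B1Eq324BenfattoLemma.Site d)) I b,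
          Real.exp (psi1p s D κ a L w v m z + psi2 s D κ a L w m z) ∂((gaussianFieldOfKernel (Kb m)).map
              fun (ζ : B1Eq324BenfattoLemma.Site d → ℝ) (x : B1Eq324BenfattoLemma.Site d) => condMean K (C ∪ corridors L w B) ξ x + ζ x) := by
  intro m hmB ξ hξ hξC
  have hA' : A.PosDef := posDef_of_coercive hAs hγA0 hγA
  -- R0 for the part kernel and for the class kernel
  have hKbpsd : IsPosSemidefKernel (Kb m) :=
    isPosSemidefKernel_kernel (hKb m hmB) (hA'.submatrix fun a b hab => Subtype.ext (by simpa using congrArg Subtype.val hab))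
  have hKpsd : IsPosSemidefKernel K := isPosSemidefKernel_kernel hK hA'
  -- R1 from row (a)
  have hdiag : ∀ y, Kb m y y ≤ (K₀.toNNReal : ℝ) := fun y =>
    ((le_abs_self _).trans (hKR m hmB y y)).trans (Real.le_coe_toNNReal K₀)
  have hdiagr : ∀ y, K y y ≤ (K₀.toNNReal : ℝ) := fun y =>
    ((le_abs_self _).trans (hKrR y y)).trans (Real.le_coe_toNNReal K₀)
  -- the datum on `Γ₁`
  have hξ' : ∀ c ∈ corridors L w B, |ξ c| ≤ γ * b * (1 + distToRegion I c) := fun c hc => by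
    have h := hξ
    simp only [smallFieldOn, Set.mem_setOf_eq] at h
    exact h c (Finset.mem_coe.2 hc)
  -- the conditioning row (h) for the union `C ∪ Γ₁`, restricted to `Γ₁`
  have hP : shrink L m w ⊆ Λ \ (C ∪ corridors L w B) := fun x hx => by
    have h1 := Finset.mem_sdiff.mp (shrink_subset_sdiff_corridors hL hBΛ hmB hx)
    exact Finset.mem_sdiff.mpr ⟨h1.1, fun h => (Finset.mem_union.mp h).elim
      (fun hC => Finset.disjoint_left.mp (hCsh m hmB) hx hC) h1.2⟩
  have hae' := partField_ae_eqOn hK hA' (Finset.union_subset hCΛ hΓΛ) hP (hKb m hmB) ξ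
  have hae : ∀ᵐ z ∂((gaussianFieldOfKernel (Kb m)).map
      fun (ζ : B1Eq324BenfattoLemma.Site d → ℝ) (x : B1Eq324BenfattoLemma.Site d) => condMean K (C ∪ corridors L w B) ξ x + ζ x),
      ∀ c ∈ corridors L w B, z c = ξ c :=
    hae'.mono fun z hz c hc => hz c (Finset.mem_union_right C hc)
  exact (perBox_shift_appD hKbpsd (condMean K (C ∪ corridors L w B) ξ) hdiag hKpsd hdiagr hκ hJ hJI hAc0 hA hv hb hγ1 hKu hKuK hK₀1
    hε₃₁ (hu ξ hξ hξC) (hKR m hmB) hKrR (hdec m hmB) (huε m hmB ξ hξ hξC) (hKε m hmB) (hvar m hmB) (hm m hmB ξ hξ hξC)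
    (frame1_subset_corridors L w hmB) hξ' hae (hsmall m hmB) (T m) (hT0 m) (hT1 m) (hT2 m) (hM m) hδ0 hδle (hMt m) t).2.2.2.2


end HBox

end Literature.MathematicalPhysics.QuantumFieldTheory.Balaban1983to89.B1Eq324BenfattoKernelSect5PerBoxAtPavementUpper

end
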